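import Literature.Analysis.SpecialFunctions.SechCosineTransform
import Mathlib.MeasureTheory.Integral.Prod
import Mathlib.MeasureTheory.Group.Integral
import Mathlib.MeasureTheory.Measure.Haar.NormedSpace
import Mathlib.Analysis.SpecialFunctions.Integrals.Basic
import HarnessLib

/-!
# Convolution powers of `sech` at the origin: `sech^{*(n+1)}(0) = π^{n-1} ∫_ℝ sech^{n+1}`

This file evaluates the iterated convolutions of the hyperbolic secant `sech x = 1/cosh x`,

`f₀ = sech`, `f_{n+1}(a) = ∫_ℝ sech(a - b) f_n(b) db` (`sechConv n`),

in closed form at every point through the cosine transform of `sech` already in the tree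
(`integral_univ_cos_div_cosh`: `∫_ℝ cos(ωx)/cosh(bx) dx = (π/b)/cosh(πω/(2b))`, file
`SechCosineTransform.lean`):

* `sechConv_eq_integral_sechHat_pow` — `f_n(a) = (1/2π) ∫_ℝ ψ(k)^{n+1} cos(ka) dk` with
  `ψ(k) = ∫ cos(kx) sech x dx = π / cosh(πk/2)` (`sechHat`), by induction on `n` (Fubini and
  `∫ sech(a-b) cos(kb) db = ψ(k) cos(ka)`); in particular `f_n` is continuous, `0 ≤ f_n ≤ πⁿ`;
* `sechConv_apply_zero` — `f_n(0) = πⁿ/π · J_{n+1}`, `J_m = ∫_ℝ sech^m` (`sechPowIntegral m`), by the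
  substitution `k = 2u/π`;
* `sechPowIntegral_one/two/rec/odd/even` — `J₁ = π`, `J₂ = 2`, `(m+1) J_{m+2} = m J_m` (from
  `(sech^m tanh)' = -m sech^m + (m+1) sech^{m+2}`), hence the Wallis-type closed forms
  `J_{2m+1} = π ∏_{i<m} (2i+1)/(2i+2)`, `J_{2m+2} = 2 ∏_{i<m} (2i+2)/(2i+3)`.

These are the analytic inputs of the evaluation of Tosi's basic cellular integrals
`ξ_l = ∫_{(0,1)^l} dx/∏(1 - x_i x_{i+1})` (`Literature.NumberTheory.Irrationality.Tosi2026`): after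
`x = tanh a` and a cyclic-symmetry argument, `(l+1) ξ_l = f_l(0)`.

## References

* [Baten1934] W. D. Baten, *The probability law for the sum of `n` independent variables, each subject
  to the law `(1/(2h)) sech(πx/(2h))`*, Bull. AMS 40 (1934) 284–290, §2: the density of the sum is (a
  multiple of) `∫₀^∞ (eˣ + e⁻ˣ)⁻ⁿ cos(ux/h) dx` (display p. 285), evaluated there "for even and odd values
  of `n`" by residues — our `sechConv_eq_integral_sechHat_pow` (Fourier representation of the
  convolution powers) and, at `u = 0`, the closed forms of `∫ sech^m`; here proved by Fubini from the
  cosine transform and by the reduction formula (integration by parts), not by residues.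
* [GradshteynRyzhik2015] 3.981 3 (`∫₀^∞ cos(ax)/cosh(βx) dx = (π/2β) sech(πa/2β)`, imported from
  `SechCosineTransform.lean`), 3.511 1 (`∫₀^∞ dx/cosh(ax) = π/(2a)`), §1.41 (hyperbolic functions).
-/

noncomputable section

open Real MeasureTheory Set Filter Finset
open scoped Topology

namespace Literature.Analysis.SpecialFunctions

/-! ### The hyperbolic secant -/

/-- The hyperbolic secant `sech x = 1 / cosh x` (Mathlib has no `Real.sech`). [cite: GradshteynRyzhik2015, §1.41 (hyperbolic functions)] -/
def sech (x : ℝ) : ℝ := 1 / Real.cosh x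

/-- `sech x > 0`. [cite: GradshteynRyzhik2015, §1.41 (hyperbolic functions)] -/
theorem sech_pos (x : ℝ) : 0 < sech x := by
  unfold sech; exact div_pos one_pos (Real.cosh_pos x)

/-- `sech x ≤ 1`. [cite: GradshteynRyzhik2015, §1.41 (hyperbolic functions)] -/
theorem sech_le_one (x : ℝ) : sech x ≤ 1 := by
  unfold sech
  rw [div_le_one (Real.cosh_pos x)]
  exact Real.one_le_cosh x

/-- `sech` is even. [cite: GradshteynRyzhik2015, §1.41 (hyperbolic functions)] -/
theorem sech_neg (x : ℝ) : sech (-x) = sech x := by simp [sech]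

/-- `sech 0 = 1`. [cite: GradshteynRyzhik2015, §1.41 (hyperbolic functions)] -/
theorem sech_zero : sech 0 = 1 := by simp [sech]

/-- `sech` is continuous. [cite: GradshteynRyzhik2015, §1.41 (hyperbolic functions)] -/
theorem continuous_sech : Continuous sech := by
  unfold sech
  exact continuous_const.div Real.continuous_cosh fun x => (Real.cosh_pos x).ne'

/-- `|sech x| = sech x`. [cite: GradshteynRyzhik2015, §1.41 (hyperbolic functions)] -/
theorem abs_sech (x : ℝ) : |sech x| = sech x := abs_of_pos (sech_pos x)

/-- `sech x ≤ 2 e^{-|x|}`. [cite: GradshteynRyzhik2015, §1.41 (hyperbolic functions)] -/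
theorem sech_le_two_mul_exp_neg_abs (x : ℝ) : sech x ≤ 2 * Real.exp (-|x|) := by
  unfold sech
  rw [div_le_iff₀ (Real.cosh_pos x), ← Real.cosh_abs, Real.cosh_eq]
  have hprod : Real.exp (-|x|) * Real.exp |x| = 1 := by rw [← Real.exp_add]; simp
  nlinarith [Real.exp_pos (-|x|), Real.exp_pos |x|, sq_nonneg (Real.exp (-|x|))]

/-- `sech` is integrable on `ℝ`. [cite: GradshteynRyzhik2015, 3.511 1] -/
theorem integrable_sech : Integrable sech := by
  refine Integrable.mono' ((integrable_exp_neg_mul_abs one_pos).const_mul 2)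
    continuous_sech.aestronglyMeasurable (Eventually.of_forall fun x => ?_)
  rw [Real.norm_eq_abs, abs_sech]
  simpa using sech_le_two_mul_exp_neg_abs x

/-- `sech (a - b)` is integrable in `b`. [cite: GradshteynRyzhik2015, 3.511 1] -/
theorem integrable_sech_sub (a : ℝ) : Integrable fun b : ℝ => sech (a - b) :=
  integrable_sech.comp_sub_left a

/-- Powers `sech^{n+1}` are integrable. [cite: GradshteynRyzhik2015, 3.511 1] -/
theorem integrable_sech_pow (n : ℕ) : Integrable fun u : ℝ => sech u ^ (n + 1) := by
  refine Integrable.mono' integrable_sech ((continuous_sech.pow _).aestronglyMeasurable)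
    (Eventually.of_forall fun u => ?_)
  rw [Real.norm_eq_abs, abs_pow, abs_sech, pow_succ]
  calc sech u ^ n * sech u ≤ 1 ^ n * sech u :=
        mul_le_mul_of_nonneg_right (pow_le_pow_left₀ (sech_pos u).le (sech_le_one u) n) (sech_pos u).le
    _ = sech u := by simp

/-- The derivative of `tanh`: `tanh' = sech²`. [cite: GradshteynRyzhik2015, §1.41 (hyperbolic functions)] -/
theorem hasDerivAt_tanh (x : ℝ) : HasDerivAt Real.tanh (sech x ^ 2) x := by
  have h := (Real.hasDerivAt_sinh x).div (Real.hasDerivAt_cosh x) (Real.cosh_pos x).ne'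
  have e : Real.tanh = fun y => Real.sinh y / Real.cosh y := funext Real.tanh_eq_sinh_div_cosh
  rw [e]
  refine h.congr_deriv ?_
  have hc := (Real.cosh_pos x).ne'
  have hsq := Real.cosh_sq x
  unfold sech
  field_simp
  nlinarith [hsq]

/-- The derivative of `sech`: `sech' = -sech · tanh`. [cite: GradshteynRyzhik2015, §1.41 (hyperbolic functions)] -/
theorem hasDerivAt_sech (x : ℝ) : HasDerivAt sech (-(sech x * Real.tanh x)) x := by
  have h := (Real.hasDerivAt_cosh x).inv (Real.cosh_pos x).ne'
  have e : sech = fun y => (Real.cosh y)⁻¹ := by funext y; simp [sech]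
  have hd : -Real.sinh x / Real.cosh x ^ 2 = -(sech x * Real.tanh x) := by
    rw [Real.tanh_eq_sinh_div_cosh, sech]
    have hc := (Real.cosh_pos x).ne'
    field_simp
  rw [← hd, e]
  exact h

/-- `tanh² = 1 - sech²`. [cite: GradshteynRyzhik2015, §1.41 (hyperbolic functions)] -/
theorem tanh_sq_eq (x : ℝ) : Real.tanh x ^ 2 = 1 - sech x ^ 2 := by
  rw [Real.tanh_eq_sinh_div_cosh, sech]
  have hc := (Real.cosh_pos x).ne'
  have hsq := Real.cosh_sq x
  field_simp
  linarith

/-! ### The cosine transform `ψ(k) = ∫ cos(kx) sech x dx = π / cosh(πk/2)` -/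

/-- `ψ(k) = π / cosh(πk/2)`, the cosine transform of `sech`. [cite: GradshteynRyzhik2015, 3.981 3] -/
def sechHat (k : ℝ) : ℝ := π / Real.cosh (π * k / 2)

/-- `ψ(k) = π · sech(πk/2)`. [cite: GradshteynRyzhik2015, 3.981 3] -/
theorem sechHat_eq (k : ℝ) : sechHat k = π * sech (π / 2 * k) := by
  rw [sechHat, sech, mul_one_div]
  congr 1; ring_nf

/-- `ψ > 0`. [folklore] -/
private theorem sechHat_pos (k : ℝ) : 0 < sechHat k := by
  rw [sechHat_eq]; exact mul_pos Real.pi_pos (sech_pos _)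

/-- `ψ ≤ π`. [folklore] -/
private theorem sechHat_le_pi (k : ℝ) : sechHat k ≤ π := by
  rw [sechHat_eq]
  exact mul_le_of_le_one_right Real.pi_pos.le (sech_le_one _)

/-- `ψ` is continuous. [folklore] -/
private theorem continuous_sechHat : Continuous sechHat := by
  have : sechHat = fun k => π * sech (π / 2 * k) := funext sechHat_eq
  rw [this]
  exact continuous_const.mul (continuous_sech.comp (continuous_const.mul continuous_id))

/-- `ψ` is integrable. [folklore] -/
private theorem integrable_sechHat : Integrable sechHat := by
  have : sechHat = fun k => π * sech (π / 2 * k) := funext sechHat_eq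
  rw [this]
  exact (integrable_sech.comp_mul_left' (by positivity : (π / 2 : ℝ) ≠ 0)).const_mul π

/-- The powers `ψ^{n+1}` are integrable. [folklore] -/
private theorem integrable_sechHat_pow (n : ℕ) : Integrable fun k : ℝ => sechHat k ^ (n + 1) := by
  refine Integrable.mono' (integrable_sechHat.const_mul (π ^ n))
    ((continuous_sechHat.pow _).aestronglyMeasurable) (Eventually.of_forall fun k => ?_)
  rw [Real.norm_eq_abs, abs_pow, abs_of_pos (sechHat_pos k), pow_succ]
  exact mul_le_mul_of_nonneg_right (pow_le_pow_left₀ (sechHat_pos k).le (sechHat_le_pi k) n)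
    (sechHat_pos k).le

/-- **The cosine transform of `sech`**: `∫_ℝ cos(kx) sech x dx = π / cosh(πk/2)`. [cite: GradshteynRyzhik2015, 3.981 3] -/
theorem integral_cos_mul_sech (k : ℝ) : ∫ x : ℝ, Real.cos (k * x) * sech x = sechHat k := by
  have h := integral_univ_cos_div_cosh one_pos k
  simp only [one_mul, mul_one, div_one] at h
  rw [sechHat, ← h]
  refine integral_congr_ae (Eventually.of_forall fun x => ?_)
  simp only [sech]
  ring

/-- `∫_ℝ sech = π`. [cite: GradshteynRyzhik2015, 3.511 1] -/
theorem integral_sech : ∫ x : ℝ, sech x = π := by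
  have h := integral_cos_mul_sech 0
  simp only [zero_mul, Real.cos_zero, one_mul] at h
  rw [h, sechHat]; simp

/-- `∫_ℝ sin(kx) sech x dx = 0` (odd integrand). [folklore] -/
private theorem integral_sin_mul_sech (k : ℝ) : ∫ x : ℝ, Real.sin (k * x) * sech x = 0 := by
  have h := integral_neg_eq_self (fun x : ℝ => Real.sin (k * x) * sech x) volume
  simp only [mul_neg, Real.sin_neg, sech_neg, neg_mul, integral_neg] at h
  linarith

/-- `cos(kx) sech x` is continuous. [folklore] -/
private theorem continuous_cos_mul_sech (k : ℝ) : Continuous fun x : ℝ => Real.cos (k * x) * sech x :=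
  (Real.continuous_cos.comp (continuous_const.mul continuous_id)).mul continuous_sech

/-- `sin(kx) sech x` is continuous. [folklore] -/
private theorem continuous_sin_mul_sech (k : ℝ) : Continuous fun x : ℝ => Real.sin (k * x) * sech x :=
  (Real.continuous_sin.comp (continuous_const.mul continuous_id)).mul continuous_sech

/-- `cos(kx) sech x` is integrable. [folklore] -/
private theorem integrable_cos_mul_sech (k : ℝ) : Integrable fun x : ℝ => Real.cos (k * x) * sech x := by
  refine Integrable.mono' integrable_sech (continuous_cos_mul_sech k).aestronglyMeasurable
    (Eventually.of_forall fun x => ?_)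
  rw [norm_mul, Real.norm_eq_abs, Real.norm_eq_abs, abs_sech]
  exact mul_le_of_le_one_left (sech_pos x).le (Real.abs_cos_le_one _)

/-- `sin(kx) sech x` is integrable. [folklore] -/
private theorem integrable_sin_mul_sech (k : ℝ) : Integrable fun x : ℝ => Real.sin (k * x) * sech x := by
  refine Integrable.mono' integrable_sech (continuous_sin_mul_sech k).aestronglyMeasurable
    (Eventually.of_forall fun x => ?_)
  rw [norm_mul, Real.norm_eq_abs, Real.norm_eq_abs, abs_sech]
  exact mul_le_of_le_one_left (sech_pos x).le (Real.abs_sin_le_one _)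

/-- **`sech` is an eigenfunction source for the convolution**: `∫_ℝ sech(a-b) cos(kb) db = ψ(k) cos(ka)`.
[cite: GradshteynRyzhik2015, 3.981 3] -/
theorem integral_sech_sub_mul_cos (a k : ℝ) :
    ∫ b : ℝ, sech (a - b) * Real.cos (k * b) = sechHat k * Real.cos (k * a) := by
  have hsub := integral_sub_left_eq_self (fun c : ℝ => sech c * Real.cos (k * (a - c))) volume a
  simp only [sub_sub_cancel] at hsub
  rw [hsub]
  have hsplit : (fun c : ℝ => sech c * Real.cos (k * (a - c))) = fun c =>
      Real.cos (k * a) * (Real.cos (k * c) * sech c) + Real.sin (k * a) * (Real.sin (k * c) * sech c) := by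
    funext c
    rw [mul_sub, Real.cos_sub]
    ring
  rw [hsplit, integral_add ((integrable_cos_mul_sech k).const_mul _)
    ((integrable_sin_mul_sech k).const_mul _), integral_const_mul, integral_const_mul,
    integral_cos_mul_sech, integral_sin_mul_sech]
  ring

/-! ### The convolution powers `f_n = sech^{*(n+1)}` -/

/-- `f₀ = sech`, `f_{n+1}(a) = ∫_ℝ sech(a-b) f_n(b) db`: `f_n` is the `(n+1)`-fold convolution power
of `sech`. [cite: Baten1934, §2 (display p. 285)] -/
def sechConv : ℕ → ℝ → ℝ
  | 0 => sech
  | n + 1 => fun a => ∫ b : ℝ, sech (a - b) * sechConv n b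

/-- `f₀ = sech`. [cite: Baten1934, §2 (display p. 285)] -/
@[simp] theorem sechConv_zero : sechConv 0 = sech := rfl

/-- The defining recursion of `f_{n+1}`. [cite: Baten1934, §2 (display p. 285)] -/
theorem sechConv_succ (n : ℕ) (a : ℝ) :
    sechConv (n + 1) a = ∫ b : ℝ, sech (a - b) * sechConv n b := rfl

/-- `f_n ≥ 0`. [cite: Baten1934, §2 (display p. 285)] -/
theorem sechConv_nonneg : ∀ (n : ℕ) (a : ℝ), 0 ≤ sechConv n a
  | 0, a => (sech_pos a).le
  | n + 1, a => by
      rw [sechConv_succ]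
      exact integral_nonneg fun b => mul_nonneg (sech_pos _).le (sechConv_nonneg n b)

/-- `f_n ≤ πⁿ`. [cite: Baten1934, §2 (display p. 285)] -/
theorem sechConv_le : ∀ (n : ℕ) (a : ℝ), sechConv n a ≤ π ^ n
  | 0, a => by simpa using sech_le_one a
  | n + 1, a => by
      rw [sechConv_succ]
      calc ∫ b : ℝ, sech (a - b) * sechConv n b ≤ ∫ b : ℝ, sech (a - b) * π ^ n := by
            refine integral_mono_of_nonneg (Eventually.of_forall fun b =>
              mul_nonneg (sech_pos _).le (sechConv_nonneg n b)) ((integrable_sech_sub a).mul_const _)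
              (Eventually.of_forall fun b => ?_)
            exact mul_le_mul_of_nonneg_left (sechConv_le n b) (sech_pos _).le
        _ = π ^ n * ∫ b : ℝ, sech (a - b) := by rw [integral_mul_const, mul_comm]
        _ = π ^ (n + 1) := by
            rw [integral_sub_left_eq_self sech volume a, integral_sech, pow_succ]

/-- The integrand of the Fubini step, `(b, k) ↦ sech(a-b) ψ(k)^{n+1} cos(kb)`, is integrable on `ℝ × ℝ`.
[folklore] -/
private theorem integrable_fubini_integrand (n : ℕ) (a : ℝ) :
    Integrable (fun p : ℝ × ℝ => sech (a - p.1) * (sechHat p.2 ^ (n + 1) * Real.cos (p.2 * p.1)))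
      (volume.prod volume) := by
  have hprod : Integrable (fun p : ℝ × ℝ => sech (a - p.1) * sechHat p.2 ^ (n + 1))
      (volume.prod volume) := (integrable_sech_sub a).mul_prod (integrable_sechHat_pow n)
  refine Integrable.mono' hprod ?_ (Eventually.of_forall fun p => ?_)
  · have hc : Continuous fun p : ℝ × ℝ =>
        sech (a - p.1) * (sechHat p.2 ^ (n + 1) * Real.cos (p.2 * p.1)) := by
      have h1 : Continuous fun p : ℝ × ℝ => sech (a - p.1) :=
        continuous_sech.comp (continuous_const.sub continuous_fst)
      have h2 : Continuous fun p : ℝ × ℝ => sechHat p.2 ^ (n + 1) :=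
        (continuous_sechHat.comp continuous_snd).pow _
      exact h1.mul (h2.mul (by fun_prop))
    exact hc.aestronglyMeasurable
  · rw [norm_mul, norm_mul, Real.norm_eq_abs, Real.norm_eq_abs, Real.norm_eq_abs, abs_sech,
      abs_pow, abs_of_pos (sechHat_pos _)]
    have h1 := Real.abs_cos_le_one (p.2 * p.1)
    have h2 : 0 ≤ sech (a - p.1) * sechHat p.2 ^ (n + 1) :=
      mul_nonneg (sech_pos _).le (pow_nonneg (sechHat_pos _).le _)
    calc sech (a - p.1) * (sechHat p.2 ^ (n + 1) * |Real.cos (p.2 * p.1)|)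
        = sech (a - p.1) * sechHat p.2 ^ (n + 1) * |Real.cos (p.2 * p.1)| := by ring
      _ ≤ sech (a - p.1) * sechHat p.2 ^ (n + 1) * 1 := mul_le_mul_of_nonneg_left h1 h2
      _ = sech (a - p.1) * sechHat p.2 ^ (n + 1) := mul_one _

/-- **Fourier representation of the convolution powers**:
`f_n(a) = (1/2π) ∫_ℝ ψ(k)^{n+1} cos(ka) dk`, `ψ(k) = π/cosh(πk/2)`. [cite: Baten1934, §2 (display p. 285)] -/
theorem sechConv_eq_integral_sechHat_pow : ∀ (n : ℕ) (a : ℝ),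
    sechConv n a = 1 / (2 * π) * ∫ k : ℝ, sechHat k ^ (n + 1) * Real.cos (k * a)
  | 0, a => by
      -- the cosine transform of `ψ` is `2π sech` (self-reciprocity, `b = π/2`)
      have h := integral_univ_cos_div_cosh (by positivity : (0 : ℝ) < π / 2) a
      have hπ : (π : ℝ) ≠ 0 := Real.pi_ne_zero
      have e1 : (fun k : ℝ => sechHat k ^ (0 + 1) * Real.cos (k * a)) =
          fun k => π * (Real.cos (a * k) / Real.cosh (π / 2 * k)) := by
        funext k
        rw [zero_add, pow_one, sechHat, mul_comm k a]
        have : π * k / 2 = π / 2 * k := by ring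
        rw [this]; ring
      rw [sechConv_zero, e1, integral_const_mul, h, sech]
      have e2 : π * a / (2 * (π / 2)) = a := by field_simp
      rw [e2]
      field_simp
  | n + 1, a => by
      rw [sechConv_succ]
      have hIH : (fun b : ℝ => sech (a - b) * sechConv n b) = fun b =>
          1 / (2 * π) * ∫ k : ℝ, sech (a - b) * (sechHat k ^ (n + 1) * Real.cos (k * b)) := by
        funext b
        rw [sechConv_eq_integral_sechHat_pow n b, ← mul_assoc, mul_comm (sech (a - b)), mul_assoc,
          ← integral_const_mul]
      rw [hIH, integral_const_mul]
      congr 1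
      rw [integral_integral_swap (integrable_fubini_integrand n a)]
      refine integral_congr_ae (Eventually.of_forall fun k => ?_)
      simp only
      have e : (fun b : ℝ => sech (a - b) * (sechHat k ^ (n + 1) * Real.cos (k * b))) =
          fun b => sechHat k ^ (n + 1) * (sech (a - b) * Real.cos (k * b)) := by
        funext b; ring
      rw [e, integral_const_mul, integral_sech_sub_mul_cos, pow_succ]
      ring

/-- `f_n` is continuous. [cite: Baten1934, §2 (display p. 285)] -/
theorem continuous_sechConv (n : ℕ) : Continuous (sechConv n) := by
  have e : sechConv n = fun a => 1 / (2 * π) * ∫ k : ℝ, sechHat k ^ (n + 1) * Real.cos (k * a) :=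
    funext (sechConv_eq_integral_sechHat_pow n)
  rw [e]
  refine continuous_const.mul ?_
  refine continuous_of_dominated (F := fun a k => sechHat k ^ (n + 1) * Real.cos (k * a))
    (bound := fun k => sechHat k ^ (n + 1)) (fun a => ?_) (fun a => ?_) (integrable_sechHat_pow n) ?_
  · exact (Continuous.mul (continuous_sechHat.pow _) (by fun_prop)).aestronglyMeasurable
  · refine Eventually.of_forall fun k => ?_
    rw [norm_mul, Real.norm_eq_abs, Real.norm_eq_abs, abs_pow, abs_of_pos (sechHat_pos _)]
    exact mul_le_of_le_one_right (pow_nonneg (sechHat_pos _).le _) (Real.abs_cos_le_one _)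
  · exact Eventually.of_forall fun k => (Continuous.mul continuous_const (by fun_prop))

/-- `f_n` is measurable. [cite: Baten1934, §2 (display p. 285)] -/
theorem measurable_sechConv (n : ℕ) : Measurable (sechConv n) := (continuous_sechConv n).measurable

/-! ### `J_m = ∫_ℝ sech^m` and its reduction formula -/

/-- `J_m = ∫_ℝ sech(u)^m du`. [cite: Baten1934, §2 (display p. 285)] -/
def sechPowIntegral (m : ℕ) : ℝ := ∫ u : ℝ, sech u ^ m

/-- `J₁ = π`. [cite: Baten1934, §2 (display p. 285)] -/
theorem sechPowIntegral_one : sechPowIntegral 1 = π := by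
  simp [sechPowIntegral, integral_sech]

/-- `sech → 0` at `+∞`. [cite: GradshteynRyzhik2015, §1.41 (hyperbolic functions)] -/
theorem tendsto_sech_atTop : Tendsto sech atTop (𝓝 0) := by
  have h : Tendsto (fun x : ℝ => 2 * Real.exp (-|x|)) atTop (𝓝 (2 * 0)) := by
    refine Tendsto.const_mul 2 ?_
    have : Tendsto (fun x : ℝ => -|x|) atTop atBot := by
      refine tendsto_neg_atTop_atBot.comp ?_
      exact tendsto_abs_atTop_atTop
    exact Real.tendsto_exp_atBot.comp this
  rw [mul_zero] at h
  exact tendsto_of_tendsto_of_tendsto_of_le_of_le tendsto_const_nhds h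
    (fun x => (sech_pos x).le) sech_le_two_mul_exp_neg_abs

/-- `sech → 0` at `-∞`. [cite: GradshteynRyzhik2015, §1.41 (hyperbolic functions)] -/
theorem tendsto_sech_atBot : Tendsto sech atBot (𝓝 0) := by
  have : sech = sech ∘ Neg.neg := by funext x; simp [sech_neg]
  rw [this]
  exact tendsto_sech_atTop.comp tendsto_neg_atBot_atTop

/-- `sech^{m+1} · tanh → 0` at `±∞` along any filter where `sech → 0`. [folklore] -/
private theorem tendsto_sech_pow_mul_tanh {l : Filter ℝ} (h : Tendsto sech l (𝓝 0)) (m : ℕ) :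
    Tendsto (fun u => sech u ^ (m + 1) * Real.tanh u) l (𝓝 0) := by
  have hb : ∀ u, |sech u ^ (m + 1) * Real.tanh u| ≤ sech u := by
    intro u
    rw [abs_mul, abs_pow, abs_sech, pow_succ]
    have ht : |Real.tanh u| ≤ 1 := by
      rw [abs_le]; exact ⟨(Real.neg_one_lt_tanh u).le, (Real.tanh_lt_one u).le⟩
    have h1 : sech u ^ m ≤ 1 := pow_le_one₀ (sech_pos u).le (sech_le_one u)
    have h2 : sech u ^ m * sech u * |Real.tanh u| ≤ sech u ^ m * sech u * 1 :=
      mul_le_mul_of_nonneg_left ht (mul_nonneg (pow_nonneg (sech_pos u).le m) (sech_pos u).le)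
    have h3 : sech u ^ m * sech u * 1 ≤ 1 * sech u * 1 :=
      mul_le_mul_of_nonneg_right (mul_le_mul_of_nonneg_right h1 (sech_pos u).le) zero_le_one
    linarith
  exact squeeze_zero_norm (fun u => by rw [Real.norm_eq_abs]; exact hb u) h

/-- **Reduction formula**: `(m+2) J_{m+3} = (m+1) J_{m+1}`, i.e. `(k+1) J_{k+2} = k J_k` for `k ≥ 1`
(integrate `(sech^{m+1} tanh)' = -(m+1) sech^{m+1} + (m+2) sech^{m+3}` over `ℝ`). [cite: Baten1934, §2 (display p. 285)] -/
theorem sechPowIntegral_rec (m : ℕ) :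
    ((m : ℝ) + 2) * sechPowIntegral (m + 3) = ((m : ℝ) + 1) * sechPowIntegral (m + 1) := by
  have hderiv : ∀ u : ℝ, HasDerivAt (fun u => sech u ^ (m + 1) * Real.tanh u)
      (((m : ℝ) + 2) * sech u ^ (m + 3) - ((m : ℝ) + 1) * sech u ^ (m + 1)) u := by
    intro u
    have h1 := ((hasDerivAt_sech u).pow (m + 1)).mul (hasDerivAt_tanh u)
    refine h1.congr_deriv ?_
    have ht := tanh_sq_eq u
    simp only [Nat.add_sub_cancel, Nat.cast_add, Nat.cast_one, Pi.pow_apply]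
    linear_combination (-((m : ℝ) + 1) * sech u ^ (m + 1)) * ht
  have hint : Integrable fun u : ℝ =>
      ((m : ℝ) + 2) * sech u ^ (m + 3) - ((m : ℝ) + 1) * sech u ^ (m + 1) :=
    ((integrable_sech_pow (m + 2)).const_mul _).sub ((integrable_sech_pow m).const_mul _)
  have h := integral_of_hasDerivAt_of_tendsto hderiv hint
    (tendsto_sech_pow_mul_tanh tendsto_sech_atBot m) (tendsto_sech_pow_mul_tanh tendsto_sech_atTop m)
  rw [sub_zero, integral_sub ((integrable_sech_pow (m + 2)).const_mul _)
    ((integrable_sech_pow m).const_mul _), integral_const_mul, integral_const_mul] at h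
  unfold sechPowIntegral
  linarith

/-- `J₂ = 2` (`∫ sech² = tanh(+∞) - tanh(-∞)`). [cite: Baten1934, §2 (display p. 285)] -/
theorem sechPowIntegral_two : sechPowIntegral 2 = 2 := by
  have hderiv : ∀ u : ℝ, HasDerivAt Real.tanh (sech u ^ 2) u := hasDerivAt_tanh
  have htop : Tendsto Real.tanh atTop (𝓝 1) := by
    have e : Real.tanh = fun u => 1 - Real.exp (-u) * sech u := by
      funext u
      rw [Real.tanh_eq_sinh_div_cosh, sech, Real.sinh_eq, Real.cosh_eq]
      have hc : Real.exp u + Real.exp (-u) ≠ 0 := by positivity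
      field_simp
      ring
    rw [e]
    have h0 : Tendsto (fun u : ℝ => Real.exp (-u) * sech u) atTop (𝓝 (0 * 0)) :=
      Real.tendsto_exp_neg_atTop_nhds_zero.mul tendsto_sech_atTop
    simpa using (tendsto_const_nhds (x := (1 : ℝ))).sub h0
  have hbot : Tendsto Real.tanh atBot (𝓝 (-1)) := by
    have e : Real.tanh = fun u => -Real.tanh (-u) := by funext u; simp [Real.tanh_neg]
    rw [e]
    exact (htop.comp tendsto_neg_atBot_atTop).neg
  have h := integral_of_hasDerivAt_of_tendsto hderiv (integrable_sech_pow 1) hbot htop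
  unfold sechPowIntegral
  rw [h]; norm_num

/-- Closed form of the odd integrals: `J_{2m+1} = π ∏_{i<m} (2i+1)/(2i+2)`. [cite: Baten1934, §2 (display p. 285)] -/
theorem sechPowIntegral_odd (m : ℕ) :
    sechPowIntegral (2 * m + 1) = π * ∏ i ∈ range m, ((2 * i + 1 : ℝ) / (2 * i + 2)) := by
  induction m with
  | zero => simp [sechPowIntegral_one]
  | succ m ih =>
      have h := sechPowIntegral_rec (2 * m)
      rw [show 2 * m + 3 = 2 * (m + 1) + 1 by ring] at h
      rw [prod_range_succ, ← mul_assoc, ← ih]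
      have hne : ((2 * m : ℕ) : ℝ) + 2 ≠ 0 := by positivity
      field_simp
      push_cast at h ⊢
      linarith

/-- Closed form of the even integrals: `J_{2m+2} = 2 ∏_{i<m} (2i+2)/(2i+3)`. [cite: Baten1934, §2 (display p. 285)] -/
theorem sechPowIntegral_even (m : ℕ) :
    sechPowIntegral (2 * m + 2) = 2 * ∏ i ∈ range m, ((2 * i + 2 : ℝ) / (2 * i + 3)) := by
  induction m with
  | zero => simp [sechPowIntegral_two]
  | succ m ih =>
      have h := sechPowIntegral_rec (2 * m + 1)
      rw [show 2 * m + 1 + 3 = 2 * (m + 1) + 2 by ring, show 2 * m + 1 + 1 = 2 * m + 2 by ring] at h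
      rw [prod_range_succ, ← mul_assoc, ← ih]
      have hne : ((2 * m + 1 : ℕ) : ℝ) + 2 ≠ 0 := by positivity
      field_simp
      push_cast at h ⊢
      linarith

/-- `J_m > 0` for `m ≥ 1`. [cite: Baten1934, §2 (display p. 285)] -/
theorem sechPowIntegral_pos (m : ℕ) : 0 < sechPowIntegral (m + 1) := by
  unfold sechPowIntegral
  rw [integral_pos_iff_support_of_nonneg (fun u => pow_nonneg (sech_pos u).le _) (integrable_sech_pow m)]
  have : Function.support (fun u : ℝ => sech u ^ (m + 1)) = univ := by
    ext u
    simp only [Function.mem_support, mem_univ, iff_true]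
    exact (pow_pos (sech_pos u) _).ne'
  rw [this]; simp

/-! ### The value at the origin -/

/-- `∫_ℝ ψ^{n+1} = 2 πⁿ J_{n+1}` (substitution `k = 2u/π`). [cite: Baten1934, §2 (display p. 285)] -/
theorem integral_sechHat_pow (n : ℕ) :
    ∫ k : ℝ, sechHat k ^ (n + 1) = 2 * π ^ n * sechPowIntegral (n + 1) := by
  have e : (fun k : ℝ => sechHat k ^ (n + 1)) =
      fun k => π ^ (n + 1) * (fun u : ℝ => sech u ^ (n + 1)) (π / 2 * k) := by
    funext k; rw [sechHat_eq, mul_pow]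
  rw [e, integral_const_mul, Measure.integral_comp_mul_left (fun u : ℝ => sech u ^ (n + 1)) (π / 2)]
  rw [sechPowIntegral, smul_eq_mul, abs_of_pos (by positivity : (0:ℝ) < (π / 2)⁻¹)]
  have hπ : (π : ℝ) ≠ 0 := Real.pi_ne_zero
  field_simp
  ring

/-- **Convolution powers of `sech` at the origin**: `f_n(0) = sech^{*(n+1)}(0) = πⁿ/π · ∫_ℝ sech^{n+1}`.
[cite: Baten1934, §2 (display p. 285)] -/
theorem sechConv_apply_zero (n : ℕ) : sechConv n 0 = π ^ n / π * sechPowIntegral (n + 1) := by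
  rw [sechConv_eq_integral_sechHat_pow n 0]
  simp only [mul_zero, Real.cos_zero, mul_one]
  rw [integral_sechHat_pow]
  have hπ : (π : ℝ) ≠ 0 := Real.pi_ne_zero
  field_simp

/-- The even case in closed form: `f_{2m}(0) = π^{2m} ∏_{i<m} (2i+1)/(2i+2)`. [cite: Baten1934, §2 (display p. 285)] -/
theorem sechConv_apply_zero_even (m : ℕ) :
    sechConv (2 * m) 0 = π ^ (2 * m) * ∏ i ∈ range m, ((2 * i + 1 : ℝ) / (2 * i + 2)) := by
  rw [sechConv_apply_zero, sechPowIntegral_odd]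
  have hπ : (π : ℝ) ≠ 0 := Real.pi_ne_zero
  field_simp

/-- The odd case in closed form: `f_{2m+1}(0) = 2 π^{2m} ∏_{i<m} (2i+2)/(2i+3)`. [cite: Baten1934, §2 (display p. 285)] -/
theorem sechConv_apply_zero_odd (m : ℕ) :
    sechConv (2 * m + 1) 0 = 2 * π ^ (2 * m) * ∏ i ∈ range m, ((2 * i + 2 : ℝ) / (2 * i + 3)) := by
  rw [sechConv_apply_zero, show 2 * m + 1 + 1 = 2 * m + 2 by ring, sechPowIntegral_even]
  have hπ : (π : ℝ) ≠ 0 := Real.pi_ne_zero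
  field_simp
  ring

end Literature.Analysis.SpecialFunctions
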